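import Summits.ResolutionOfSingularities.ResolutionOfSingularities.Theorems.WeightedInvariantWeightedConstructionHullEscape

/-!
# Hull escape, hull-valued form: two-point pairs read through the hull values only

[OURS · L1 W4.3 · chain w43, stub worker 4] Variant of the hull-escape lever
(`Theorems/WeightedInvariantWeightedConstructionHullEscape.lean`, p465123) for line `pointwise-lexmax-hull`
of crux `WeightedConstruction` (stmt-ResolutionOfSingularities-0571). NOT a statement of any manuscript.

The per-pair hypotheses are now stated with the rule's `hull` VALUES instead of admissible charts:
singular points exactly `a`, `b` and `hull b < hull a`. This is the form in which the witness family
`Fₙ ⊔ Fₙ₊₁` (`Fₙ = (𝔸ⁿ, 𝔪₀²)`) is discharged WITHOUT transporting charts along the open immersions: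
by the rule's functoriality `R.HullComap` (a conjunct of the line's stub `stub_hullUsc`, assumed by the
transfer stub `stub_recoding`) the hull of the pair at `inl 0ₙ` is the hull of `Fₙ` at its origin, which
is `(2,…,2,⊤,…)` (`n` twos) by `hull_eq_plex_of_isolated_of_isClosed` and the landed fat-point value
`LexmaxHullRule.plex_fatPoint_eq` (p469569); these values strictly descend in `n`
(`twoProfile_succ_lt`, p467634).

* `LexmaxHullRule.hull_eq_plex_of_isolated_of_isClosed`: at a closed singular point that is its own only
  singular generisation, `hull = plex`.
* `LexmaxHullRule.centre_support_eq_singleton_of_hull_lt`, `ACChartPreDatum.inv_lt_of_hull_lt`: the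
  two-point pair read through hull values.
* `LexmaxHullRule.hullEscape_false_of_hull_lt` (+ `_datum`): no escape sequence with `hull bₙ < hull aₙ`,
  smooth correspondences `bₙ ~ aₙ₊₁`, and datum centre support = rule centre support.
-/

noncomputable section

open CategoryTheory AlgebraicGeometry Topology
open Literature.AlgebraicGeometry.Resolution

set_option linter.dupNamespace false -- mandated namespace of this single-conjunct summit

namespace Summit.ResolutionOfSingularities.ResolutionOfSingularities.Theorems.PointwiseLexmaxHull

namespace LexmaxHullRule

variable {p : ℕ} (R : LexmaxHullRule p)

section OnePair

variable {k : Type} [Field k] [CharP k p] [PerfectField k]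
  {Y : Scheme.{0}} (f : Y ⟶ Spec (.of k)) [Smooth f] [IsSeparated f] [QuasiCompact f]
  (X : Y.IdealSheafData)

/-- At a CLOSED singular point which is its own only singular generisation, `hull = plex`.
[OURS · folklore] -/
theorem hull_eq_plex_of_isolated_of_isClosed {y : Y} (hyc : IsClosed ({y} : Set Y)) (hys : XSing X y)
    (hiso : ∀ η : Y, η ⤳ y → XSing X η → η = y) : R.hull f X y = R.plex f X y := by
  rw [R.hull_eq_gen_of_isolated f X hys hiso, R.gen_eq_plex_of_isClosed f X hyc hys]

/-- **Two-point pair through hull values, centre.** If the singular points of `(Y, X)` are exactly `a`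
and `b` and `hull b < hull a`, the rule's centre is supported exactly on `{a}`. [OURS · folklore] -/
theorem centre_support_eq_singleton_of_hull_lt {a b : Y} (has : XSing X a)
    (hsing : ∀ y : Y, XSing X y → y = a ∨ y = b) (hlt : R.hull f X b < R.hull f X a) :
    (R.centre f X).support = {a} := by
  rw [R.support_centre f X ⟨a, has⟩]
  ext y
  simp only [Set.mem_setOf_eq, Set.mem_singleton_iff]
  constructor
  · rintro ⟨hys, hmax⟩
    rcases hsing y hys with rfl | rfl
    · rfl
    · exact absurd (hmax a has) (not_le.mpr hlt)
  · rintro rfl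
    refine ⟨has, fun y' hy's => ?_⟩
    rcases hsing y' hy's with rfl | rfl
    · exact le_rfl
    · exact hlt.le

end OnePair

end LexmaxHullRule

end Summit.ResolutionOfSingularities.ResolutionOfSingularities.Theorems.PointwiseLexmaxHull

namespace Summit.ResolutionOfSingularities.ResolutionOfSingularities.Theorems

open PointwiseLexmaxHull

namespace ACChartPreDatum

variable {p : ℕ} (D : ACChartPreDatum p)
  {k : Type} [Field k] [CharP k p] [PerfectField k]
  {Y : Scheme.{0}} (f : Y ⟶ Spec (.of k)) [Smooth f] [IsSeparated f] [QuasiCompact f]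
  (X : Y.IdealSheafData)

/-- **Two-point pair through hull values, datum.** If the singular points are exactly `a`, `b`, the
rule has `hull b < hull a`, and the datum's centre has the same support as the rule's centre, then
`inv b < inv a`. [OURS · folklore] -/
theorem inv_lt_of_hull_lt (R : LexmaxHullRule p) {a b : Y} (has : XSing X a)
    (hsing : ∀ y : Y, XSing X y → y = a ∨ y = b) (hlt : R.hull f X b < R.hull f X a)
    (hagree : (D.centre f X).support = (R.centre f X).support) :
    D.inv f X b < D.inv f X a := by
  have hsupp : (D.centre f X).support = {a} := by
    rw [hagree, R.centre_support_eq_singleton_of_hull_lt f X has hsing hlt]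
  have hab : a ≠ b := by
    rintro rfl
    exact lt_irrefl _ hlt
  refine D.inv_lt_of_not_mem_support_centre f X ⟨a, D.not_isBot_inv_of_xSing f X has⟩ ?_ ?_
  · rw [hsupp]; exact Set.mem_singleton a
  · rw [hsupp, Set.mem_singleton_iff]; exact fun h => hab h.symm

end ACChartPreDatum

end Summit.ResolutionOfSingularities.ResolutionOfSingularities.Theorems

namespace Summit.ResolutionOfSingularities.ResolutionOfSingularities.Theorems.PointwiseLexmaxHull

namespace LexmaxHullRule

variable {p : ℕ} (R : LexmaxHullRule p)

/-- **Hull escape theorem, hull-valued form.** For a rule `R` and an algebraically-closed chart pre-datum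
`D`: there is no sequence of pairs in the regime over one perfect field whose singular points are
exactly `aₙ`, `bₙ` with `hull bₙ < hull aₙ`, linked by smooth correspondences `bₙ ~ aₙ₊₁` (axiom `(i)`),
on which the support of `D`'s centre equals the support of `R`'s centre. [OURS · folklore] -/
theorem hullEscape_false_of_hull_lt (D : ACChartPreDatum p)
    (k : Type) [Field k] [CharP k p] [PerfectField k]
    (Y : ℕ → Scheme.{0}) (f : ∀ n, Y n ⟶ Spec (.of k))
    [∀ n, Smooth (f n)] [∀ n, IsSeparated (f n)] [∀ n, QuasiCompact (f n)]
    (X : ∀ n, (Y n).IdealSheafData) (a b : ∀ n, Y n)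
    (has : ∀ n, XSing (X n) (a n))
    (hsing : ∀ n (y : Y n), XSing (X n) y → y = a n ∨ y = b n)
    (hlt : ∀ n, R.hull (f n) (X n) (b n) < R.hull (f n) (X n) (a n))
    (hagree : ∀ n, (D.centre (f n) (X n)).support = (R.centre (f n) (X n)).support)
    (Z : ℕ → Scheme.{0}) (h : ∀ n, Z n ⟶ Spec (.of k))
    [∀ n, Smooth (h n)] [∀ n, IsSeparated (h n)] [∀ n, QuasiCompact (h n)]
    (g : ∀ n, Z n ⟶ Y n) (g' : ∀ n, Z n ⟶ Y (n + 1)) [∀ n, Smooth (g n)] [∀ n, Smooth (g' n)]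
    (hg : ∀ n, g n ≫ f n = h n) (hg' : ∀ n, g' n ≫ f (n + 1) = h n)
    (z : ∀ n, Z n) (hzb : ∀ n, g n (z n) = b n) (hza : ∀ n, g' n (z n) = a (n + 1))
    (hX : ∀ n, (X n).comap (g n) = (X (n + 1)).comap (g' n)) :
    False := by
  have htransfer : ∀ n, D.inv (f (n + 1)) (X (n + 1)) (a (n + 1)) = D.inv (f n) (X n) (b n) := by
    intro n
    rw [← hza n, ← hzb n, ← D.inv_comap (f (n + 1)) (h n) (g' n) (hg' n) (X (n + 1)) (z n),
      ← D.inv_comap (f n) (h n) (g n) (hg n) (X n) (z n), hX n]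
  have hlt' : ∀ n, D.inv (f (n + 1)) (X (n + 1)) (a (n + 1)) < D.inv (f n) (X n) (a n) := fun n =>
    (htransfer n).trans_lt (D.inv_lt_of_hull_lt (f n) (X n) R (has n) (hsing n) (hlt n) (hagree n))
  obtain ⟨n, hn⟩ :=
    WellFounded.not_rel_apply_succ (r := (· < ·)) (fun n => D.inv (f n) (X n) (a n))
  exact hn (hlt' n)

/-- **Hull escape theorem, hull-valued form, for full data.** [OURS · folklore] -/
theorem hullEscape_false_of_hull_lt_datum (D : WeightedResolutionDatum p)
    (k : Type) [Field k] [CharP k p] [PerfectField k]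
    (Y : ℕ → Scheme.{0}) (f : ∀ n, Y n ⟶ Spec (.of k))
    [∀ n, Smooth (f n)] [∀ n, IsSeparated (f n)] [∀ n, QuasiCompact (f n)]
    (X : ∀ n, (Y n).IdealSheafData) (a b : ∀ n, Y n)
    (has : ∀ n, XSing (X n) (a n))
    (hsing : ∀ n (y : Y n), XSing (X n) y → y = a n ∨ y = b n)
    (hlt : ∀ n, R.hull (f n) (X n) (b n) < R.hull (f n) (X n) (a n))
    (hagree : ∀ n, (D.centre (f n) (X n)).support = (R.centre (f n) (X n)).support)
    (Z : ℕ → Scheme.{0}) (h : ∀ n, Z n ⟶ Spec (.of k))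
    [∀ n, Smooth (h n)] [∀ n, IsSeparated (h n)] [∀ n, QuasiCompact (h n)]
    (g : ∀ n, Z n ⟶ Y n) (g' : ∀ n, Z n ⟶ Y (n + 1)) [∀ n, Smooth (g n)] [∀ n, Smooth (g' n)]
    (hg : ∀ n, g n ≫ f n = h n) (hg' : ∀ n, g' n ≫ f (n + 1) = h n)
    (z : ∀ n, Z n) (hzb : ∀ n, g n (z n) = b n) (hza : ∀ n, g' n (z n) = a (n + 1))
    (hX : ∀ n, (X n).comap (g n) = (X (n + 1)).comap (g' n)) :
    False :=
  R.hullEscape_false_of_hull_lt (ACChartPreDatum.ofPreDatum (PreDatum.ofDatum D)) k Y f X a b has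
    hsing hlt hagree Z h g g' hg hg' z hzb hza hX

end LexmaxHullRule

end Summit.ResolutionOfSingularities.ResolutionOfSingularities.Theorems.PointwiseLexmaxHull

end
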